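/-
Copyright (c) 2026 the pub-hodgecm-mathlib formalisation cell (harness21).  Prover seat hodgecm-mathlib-F0P3a-p02 (g18): road «S3-ram», (Cnt2′) ROUTE B (chair
F0P3a-p07 (g15) RULINGS (17)–(18)): the finite law of a type-(2) root in the ι-SHAPE currency of the hyperbolic literal; 2026-09-02.
-/
import Literature.NumberTheory.Rogawski1990.DepthZeroKappaTransferTypeTwoRamifiedBlockRootCensusAffine   -- ★ p849444 (this seat): the general finite law
import Literature.NumberTheory.Automorphic.UnitaryGroupRankOneBigCell                                 -- ★ `UnitaryGroup.antidiagonal_three_over_eq`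
import HarnessLib

/-!
# The type-(2) root census, V: the hyperbolic literal in ι-shape — NULL and CLASS root lines read off the residual matrix `Ȳ = ι(Ȳ_W, 0)`
# (Rogawski 1990 §4.9; Kottwitz 1986 §3)

Topic `NumberTheory/Rogawski1990`; namespace `Literature.NumberTheory.Rogawski1990.TypeTwoBlockRoot` (continues ★ `…BlockRootCensusAffine`).  THEOREMS ONLY (no definition, no
instance, no notation, no named fact, no `sorry`); kernel lane `--supports stmt-HodgeConjecture-24833` (cell `pub/hodgecm-mathlib`, crux H413, road «S3-ram», count-neutral).
ADAPTER for the pens of the hyperbolic literal (F0P3a-p01 (g18) ★ `…HyperbolicRootResidual` ∕ ★ `…RootValueLines`, assembler F0P3-p01 (g19), chair RULING (18)): their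
residual matrix has the ι-SHAPE `Ȳ = !![β, 0, y; 0, 0, 0; x, 0, β]` (`Ȳ₀₁ = Ȳ₁₀ = Ȳ₁₁ = Ȳ₁₂ = Ȳ₂₁ = 0`, `Ȳ₂₂ = Ȳ₀₀` = unitarity at odd depth, `χ(xy) = −1` = residual
irreducibility), with respect to the ANTIDIAGONAL Gram `J̄₀`.  The hyperbolic eigenframe `Ā = (e₀ + e₂ | e₁ | e₀ − e₂)` has `ᵗĀJ̄₀Ā = diag(2, 1, −2)` and carries `Ȳ` to the
self-adjoint block `((β + (x+y)∕2, (x−y)∕2), ((y−x)∕2, β − (x+y)∕2))` against the isolated index `1`; feeding ★ `natCard_params_blockFrame_null_eq'` ∕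
★ `two_mul_natCard_params_blockFrame_quadraticChar_eq'` (relative trace `2β`, discriminant `4xy`, `det' = β² − xy`, `χ(2c₀·1·2·(−2)) = χ(−2c₀)`):
**`#{p : Q_Ȳ(x_p) = 0} = 1 + χ(β² − xy)`** (F0P3a-p01 (g18)'s ★ `natCard_conicNull_of_iotaShape`, both cases at once) and
**`2·#{p : χ(c₀Q_Ȳ(x_p)) = ε} = q − χ(β² − xy) + ε·χ(−2c₀)·Σ_v χ(v + 2β)·χ(v² − 4xy)`** — the hyperbolic half of the joint pm cell, tie (`β ≠ 0`) included.
HONEST LABEL: HC_CM is proved only modulo the 2 remaining named inputs (hLiu418 24832, h413 24833) until rung 0 closes; finite-field algebra only, nothing printed is asserted.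

## References
* [Rogawski1990] J. D. Rogawski, *Automorphic Representations of Unitary Groups in Three Variables*, Ann. of Math. Stud. 123 (1990), §4.9 Prop. 4.9.1 p. 55, §1.9 p. 8.
* [Kottwitz1986] R. E. Kottwitz, *Base change for unit elements of Hecke algebras*, Compositio Math. 60 (1986), §3.
* [LidlNiederreiter1996] R. Lidl, H. Niederreiter, *Finite Fields*, 2nd ed. (1996), Def. 5.49, Thm. 6.26–6.27.
-/

set_option autoImplicit false

namespace Literature.NumberTheory.Rogawski1990.TypeTwoBlockRoot

open Finset Matrix
open Literature.NumberTheory.Automorphic Literature.NumberTheory.Automorphic.HermitianLattice Literature.NumberTheory.Automorphic.UnitaryGroup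
open Literature.LinearAlgebra.QuadraticFormCountCongruence Literature.GroupTheory.SpecificGroups
open Literature.NumberTheory.Rogawski1990

variable {k : Type*} [Field k] [Fintype k] [DecidableEq k]

omit [Fintype k] [DecidableEq k] in
/-- **THE HYPERBOLIC EIGENFRAME PACKAGE.**  For an ι-shaped `Ȳ` (`Ȳ₀₁ = Ȳ₁₀ = Ȳ₁₁ = Ȳ₁₂ = Ȳ₂₁ = 0`, `Ȳ₂₂ = Ȳ₀₀`, `χ(Ȳ₀₂Ȳ₂₀) = −1`; odd characteristic) there is a frame
`Ā ∈ GL₃(k)` with `ᵗĀ·J̄₀·Ā = diag(2, 1, −2)` such that `B := Ā⁻¹ȲĀ` is a block against the isolated index `1` (`B₁₀ = B₁₂ = B₀₁ = B₂₁ = 0`, `B₁₁ = 0`), self-adjoint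
(`2·B₀₂ = (−2)·B₂₀`), with relative trace `B₀₀ + B₂₂ − 2B₁₁ = 2Ȳ₀₀`, discriminant `(B₀₀ − B₂₂)² + 4B₀₂B₂₀ = 4Ȳ₀₂Ȳ₂₀` (a non-square) and
`2·(−2)·(B₀₂B₂₀ − (B₀₀ − B₁₁)(B₂₂ − B₁₁)) = 2²·(Ȳ₀₀² − Ȳ₀₂Ȳ₂₀)` — namely `Ā = (e₀ + e₂ | e₁ | e₀ − e₂)`. [cite: Rogawski1990, §1.9 p. 8, §4.9 Prop. 4.9.1 p. 55] -/
theorem exists_hyperbolic_eigenframe_of_iotaShape (hk : ringChar k ≠ 2) (Y : Matrix (Fin 3) (Fin 3) k)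
    (h01 : Y 0 1 = 0) (h10 : Y 1 0 = 0) (h11 : Y 1 1 = 0) (h12 : Y 1 2 = 0) (h21 : Y 2 1 = 0) (hdiag : Y 2 2 = Y 0 0) :
    ∃ A : GL (Fin 3) k,
      ((A : Matrix (Fin 3) (Fin 3) k))ᵀ * ((StdForm.antidiagonal 3).over k) * (A : Matrix (Fin 3) (Fin 3) k) = diagonal ![(2 : k), 1, -2] ∧
      (((A⁻¹ : GL (Fin 3) k) : Matrix (Fin 3) (Fin 3) k) * Y * (A : Matrix (Fin 3) (Fin 3) k)) 1 0 = 0 ∧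
      (((A⁻¹ : GL (Fin 3) k) : Matrix (Fin 3) (Fin 3) k) * Y * (A : Matrix (Fin 3) (Fin 3) k)) 1 2 = 0 ∧
      (((A⁻¹ : GL (Fin 3) k) : Matrix (Fin 3) (Fin 3) k) * Y * (A : Matrix (Fin 3) (Fin 3) k)) 0 1 = 0 ∧
      (((A⁻¹ : GL (Fin 3) k) : Matrix (Fin 3) (Fin 3) k) * Y * (A : Matrix (Fin 3) (Fin 3) k)) 2 1 = 0 ∧
      (((A⁻¹ : GL (Fin 3) k) : Matrix (Fin 3) (Fin 3) k) * Y * (A : Matrix (Fin 3) (Fin 3) k)) 1 1 = 0 ∧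
      (2 : k) * (((A⁻¹ : GL (Fin 3) k) : Matrix (Fin 3) (Fin 3) k) * Y * (A : Matrix (Fin 3) (Fin 3) k)) 0 2 =
        (-2) * (((A⁻¹ : GL (Fin 3) k) : Matrix (Fin 3) (Fin 3) k) * Y * (A : Matrix (Fin 3) (Fin 3) k)) 2 0 ∧
      (((A⁻¹ : GL (Fin 3) k) : Matrix (Fin 3) (Fin 3) k) * Y * (A : Matrix (Fin 3) (Fin 3) k)) 0 0 +
        (((A⁻¹ : GL (Fin 3) k) : Matrix (Fin 3) (Fin 3) k) * Y * (A : Matrix (Fin 3) (Fin 3) k)) 2 2 -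
        2 * (((A⁻¹ : GL (Fin 3) k) : Matrix (Fin 3) (Fin 3) k) * Y * (A : Matrix (Fin 3) (Fin 3) k)) 1 1 = 2 * Y 0 0 ∧
      ((((A⁻¹ : GL (Fin 3) k) : Matrix (Fin 3) (Fin 3) k) * Y * (A : Matrix (Fin 3) (Fin 3) k)) 0 0 -
        (((A⁻¹ : GL (Fin 3) k) : Matrix (Fin 3) (Fin 3) k) * Y * (A : Matrix (Fin 3) (Fin 3) k)) 2 2) ^ 2 +
        4 * ((((A⁻¹ : GL (Fin 3) k) : Matrix (Fin 3) (Fin 3) k) * Y * (A : Matrix (Fin 3) (Fin 3) k)) 0 2 *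
          (((A⁻¹ : GL (Fin 3) k) : Matrix (Fin 3) (Fin 3) k) * Y * (A : Matrix (Fin 3) (Fin 3) k)) 2 0) = 4 * (Y 0 2 * Y 2 0) ∧
      (2 : k) * (-2) * ((((A⁻¹ : GL (Fin 3) k) : Matrix (Fin 3) (Fin 3) k) * Y * (A : Matrix (Fin 3) (Fin 3) k)) 0 2 *
          (((A⁻¹ : GL (Fin 3) k) : Matrix (Fin 3) (Fin 3) k) * Y * (A : Matrix (Fin 3) (Fin 3) k)) 2 0 -
        ((((A⁻¹ : GL (Fin 3) k) : Matrix (Fin 3) (Fin 3) k) * Y * (A : Matrix (Fin 3) (Fin 3) k)) 0 0 -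
          (((A⁻¹ : GL (Fin 3) k) : Matrix (Fin 3) (Fin 3) k) * Y * (A : Matrix (Fin 3) (Fin 3) k)) 1 1) *
        ((((A⁻¹ : GL (Fin 3) k) : Matrix (Fin 3) (Fin 3) k) * Y * (A : Matrix (Fin 3) (Fin 3) k)) 2 2 -
          (((A⁻¹ : GL (Fin 3) k) : Matrix (Fin 3) (Fin 3) k) * Y * (A : Matrix (Fin 3) (Fin 3) k)) 1 1)) =
        (Y 0 0 ^ 2 - Y 0 2 * Y 2 0) * 2 ^ 2 := by
  have h2 : (2 : k) ≠ 0 := Ring.two_ne_zero hk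
  set t : k := (2 : k)⁻¹ with htdef
  have ht : 2 * t = 1 := mul_inv_cancel₀ h2
  have htt : t + t = 1 := by linear_combination ht
  let Am : Matrix (Fin 3) (Fin 3) k := !![1, 0, 1; 0, 1, 0; 1, 0, -1]
  let Ai : Matrix (Fin 3) (Fin 3) k := !![t, 0, t; 0, 1, 0; t, 0, -t]
  have hmul : Am * Ai = 1 := by
    ext i j
    fin_cases i <;> fin_cases j <;> simp [Am, Ai, Matrix.mul_apply, Fin.sum_univ_three, htt]
  have hmul' : Ai * Am = 1 := by
    ext i j
    fin_cases i <;> fin_cases j <;> simp [Am, Ai, Matrix.mul_apply, Fin.sum_univ_three, htt]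
  let A : GL (Fin 3) k := ⟨Am, Ai, hmul, hmul'⟩
  have hcoe : ((A : GL (Fin 3) k) : Matrix (Fin 3) (Fin 3) k) = Am := rfl
  have hcoe' : ((A⁻¹ : GL (Fin 3) k) : Matrix (Fin 3) (Fin 3) k) = Ai := rfl
  have hB : Ai * Y * Am = !![t * (2 * Y 0 0 + Y 2 0 + Y 0 2), 0, t * (Y 2 0 - Y 0 2); 0, 0, 0; t * (Y 0 2 - Y 2 0), 0, t * (2 * Y 0 0 - Y 2 0 - Y 0 2)] := by
    ext i j
    simp only [Matrix.mul_apply, Fin.sum_univ_three]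
    fin_cases i <;> fin_cases j <;> simp [Am, Ai, h01, h10, h11, h12, h21, hdiag] <;> ring
  refine ⟨A, ?_, ?_⟩
  · rw [hcoe, antidiagonal_three_over_eq]
    ext i j
    simp only [Matrix.mul_apply, Fin.sum_univ_three, Matrix.transpose_apply]
    fin_cases i <;> fin_cases j <;> simp [Am, Matrix.diagonal] <;> norm_num
  rw [hcoe, hcoe', hB]
  simp only [Matrix.of_apply, Matrix.cons_val', Matrix.cons_val_zero, Matrix.cons_val_one, Matrix.cons_val_two, Matrix.empty_val',
    Matrix.cons_val_fin_one, Matrix.head_cons, Matrix.tail_cons, Matrix.head_fin_const]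
  refine ⟨trivial, trivial, trivial, trivial, trivial, by ring, by linear_combination (2 * Y 0 0) * ht, ?_, ?_⟩
  · linear_combination (4 * (Y 0 2 * Y 2 0) * (2 * t + 1)) * ht
  · linear_combination (4 * (Y 0 0 ^ 2 - Y 0 2 * Y 2 0) * (2 * t + 1)) * ht

/-- **NULL ROOT LINES OF THE HYPERBOLIC LITERAL, ι-shape currency: `#{p : Q_Ȳ(x_p) = 0} = 1 + χ(Ȳ₀₀² − Ȳ₀₂Ȳ₂₀)`** (binders of F0P3a-p01 (g18)'s
★ `natCard_conicNull_of_iotaShape` verbatim; both of its cases at once): `2` null root lines iff `det Ȳ_W = Ȳ₀₀² − Ȳ₀₂Ȳ₂₀` is a square.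
[cite: Rogawski1990, §4.9 Prop. 4.9.1 p. 55] [cite: Kottwitz1986, §3] -/
theorem natCard_params_iotaShape_null_eq (hk : ringChar k ≠ 2) (Y : Matrix (Fin 3) (Fin 3) k)
    (h01 : Y 0 1 = 0) (h10 : Y 1 0 = 0) (h11 : Y 1 1 = 0) (h12 : Y 1 2 = 0) (h21 : Y 2 1 = 0)
    (hdiag : Y 2 2 = Y 0 0) (hirr : quadraticChar k (Y 0 2 * Y 2 0) = -1) :
    ((Nat.card {p : Option {p : k × k // p.2 + (RingHom.id k) p.2 + p.1 * (RingHom.id k) p.1 = 0} //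
        (p.elim (Pi.single 2 1) fun q => ![(1 : k), q.1.1, q.1.2]) ⬝ᵥ
          (((((StdForm.antidiagonal 3).over k) * Y) *ᵥ (p.elim (Pi.single 2 1) fun q => ![(1 : k), q.1.1, q.1.2]))) = 0} : ℕ) : ℤ) =
      1 + quadraticChar k (Y 0 0 ^ 2 - Y 0 2 * Y 2 0) := by
  have h2 : (2 : k) ≠ 0 := Ring.two_ne_zero hk
  obtain ⟨A, hG, hB10, hB12, hB01, hB21, hB11, hadj, -, hdisc, hdet⟩ := exists_hyperbolic_eigenframe_of_iotaShape hk Y h01 h10 h11 h12 h21 hdiag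
  set B : Matrix (Fin 3) (Fin 3) k := ((A⁻¹ : GL (Fin 3) k) : Matrix (Fin 3) (Fin 3) k) * Y * (A : Matrix (Fin 3) (Fin 3) k) with hBdef
  have hδ : ∀ m : Fin 3, (![(2 : k), 1, -2]) m ≠ 0 := by
    intro m; fin_cases m <;> simp [h2]
  have hadj' : (![(2 : k), 1, -2]) 0 * B 0 2 = (![(2 : k), 1, -2]) 2 * B 2 0 := by simpa using hadj
  have hirr' : quadraticChar k ((B 0 0 - B 2 2) ^ 2 + 4 * (B 0 2 * B 2 0)) = -1 := by
    rw [hdisc, show (4 : k) * (Y 0 2 * Y 2 0) = Y 0 2 * Y 2 0 * 2 ^ 2 by ring, map_mul, map_pow, quadraticChar_sq_one h2, mul_one]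
    exact hirr
  have h := natCard_params_blockFrame_null_eq' hk (i₀ := (1 : Fin 3)) (j := 0) (l := 2) (by decide) (by decide) (by decide) ![(2 : k), 1, -2] hδ B
    hB10 hB12 hB01 hB21 hadj' hirr' A Y hG hBdef.symm
  rw [h]
  congr 1
  have h4 : (![(2 : k), 1, -2]) 0 * (![(2 : k), 1, -2]) 2 * (B 0 2 * B 2 0 - (B 0 0 - B 1 1) * (B 2 2 - B 1 1)) =
      (Y 0 0 ^ 2 - Y 0 2 * Y 2 0) * 2 ^ 2 := by simpa using hdet
  rw [h4, map_mul, map_pow, quadraticChar_sq_one h2, mul_one]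

/-- **CLASS ROOT LINES OF THE HYPERBOLIC LITERAL, ι-shape currency (doubled):
`2·#{p : χ(c₀·Q_Ȳ(x_p)) = ε} = q − χ(Ȳ₀₀² − Ȳ₀₂Ȳ₂₀) + ε·χ(−2c₀)·Σ_v χ(v + 2Ȳ₀₀)·χ(v² − 4Ȳ₀₂Ȳ₂₀)`** (`c₀ ≠ 0`, `ε = ±1`; the tie `Ȳ₀₀ ≠ 0` included) — the hyperbolic
half of the joint pm cell; with F0P3-p01 (g19)'s ★ `crossLiteral_of_blockRootCensus` the anisotropic twin differs by exactly one line per class.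
[cite: Rogawski1990, §4.9 Prop. 4.9.1 p. 55] [cite: Kottwitz1986, §3] [cite: LidlNiederreiter1996, Def. 5.49] -/
theorem two_mul_natCard_params_iotaShape_quadraticChar_eq (hk : ringChar k ≠ 2) (Y : Matrix (Fin 3) (Fin 3) k)
    (h01 : Y 0 1 = 0) (h10 : Y 1 0 = 0) (h11 : Y 1 1 = 0) (h12 : Y 1 2 = 0) (h21 : Y 2 1 = 0)
    (hdiag : Y 2 2 = Y 0 0) (hirr : quadraticChar k (Y 0 2 * Y 2 0) = -1) (c₀ : k) (hc₀ : c₀ ≠ 0) {ε : ℤ} (hε : ε = 1 ∨ ε = -1) :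
    2 * ((Nat.card {p : Option {p : k × k // p.2 + (RingHom.id k) p.2 + p.1 * (RingHom.id k) p.1 = 0} //
        quadraticChar k (c₀ * ((p.elim (Pi.single 2 1) fun q => ![(1 : k), q.1.1, q.1.2]) ⬝ᵥ
          (((((StdForm.antidiagonal 3).over k) * Y) *ᵥ (p.elim (Pi.single 2 1) fun q => ![(1 : k), q.1.1, q.1.2]))))) = ε} : ℕ) : ℤ) =
      Fintype.card k - quadraticChar k (Y 0 0 ^ 2 - Y 0 2 * Y 2 0) +
        ε * quadraticChar k (-2 * c₀) * ∑ v : k, quadraticChar k (v + 2 * Y 0 0) * quadraticChar k (v ^ 2 - 4 * (Y 0 2 * Y 2 0)) := by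
  have h2 : (2 : k) ≠ 0 := Ring.two_ne_zero hk
  obtain ⟨A, hG, hB10, hB12, hB01, hB21, hB11, hadj, htr, hdisc, hdet⟩ := exists_hyperbolic_eigenframe_of_iotaShape hk Y h01 h10 h11 h12 h21 hdiag
  set B : Matrix (Fin 3) (Fin 3) k := ((A⁻¹ : GL (Fin 3) k) : Matrix (Fin 3) (Fin 3) k) * Y * (A : Matrix (Fin 3) (Fin 3) k) with hBdef
  have hδ : ∀ m : Fin 3, (![(2 : k), 1, -2]) m ≠ 0 := by
    intro m; fin_cases m <;> simp [h2]
  have hadj' : (![(2 : k), 1, -2]) 0 * B 0 2 = (![(2 : k), 1, -2]) 2 * B 2 0 := by simpa using hadj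
  have hirr' : quadraticChar k ((B 0 0 - B 2 2) ^ 2 + 4 * (B 0 2 * B 2 0)) = -1 := by
    rw [hdisc, show (4 : k) * (Y 0 2 * Y 2 0) = Y 0 2 * Y 2 0 * 2 ^ 2 by ring, map_mul, map_pow, quadraticChar_sq_one h2, mul_one]
    exact hirr
  have h := two_mul_natCard_params_blockFrame_quadraticChar_eq' hk (i₀ := (1 : Fin 3)) (j := 0) (l := 2) (by decide) (by decide) (by decide)
    ![(2 : k), 1, -2] hδ B hB10 hB12 hB01 hB21 hadj' hirr' A Y hG hBdef.symm c₀ hc₀ hε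
  rw [h, htr, hdisc]
  have h4 : (![(2 : k), 1, -2]) 0 * (![(2 : k), 1, -2]) 2 * (B 0 2 * B 2 0 - (B 0 0 - B 1 1) * (B 2 2 - B 1 1)) =
      (Y 0 0 ^ 2 - Y 0 2 * Y 2 0) * 2 ^ 2 := by simpa using hdet
  have hκ : (2 : k) * c₀ * (![(2 : k), 1, -2]) 1 * (![(2 : k), 1, -2]) 0 * (![(2 : k), 1, -2]) 2 = -2 * c₀ * 2 ^ 2 := by simp; ring
  rw [h4, hκ, map_mul, map_pow, quadraticChar_sq_one h2, mul_one, map_mul (quadraticChar k) (-2 * c₀), map_pow, quadraticChar_sq_one h2, mul_one]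

end Literature.NumberTheory.Rogawski1990.TypeTwoBlockRoot
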